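import Summits.QuantumFields.BalabanUV.Beta.GAN24.FibreKernelControl
import Summits.QuantumFields.BalabanUV.Beta.GAN24.CapacitanceCancellationDefect
import Summits.QuantumFields.BalabanUV.Beta.GAN24.CapacitanceClosedFormAlias

/-!
# `BalabanUV.Beta.GAN24.FibreKernelControlAlias` — binder row G-an2-4 / (CONV-C), road P1-fibre, self-row **N15k-ker*** PART 3:
# the five displayed constants of PART 2 for the ALIAS FIBRE `AliasObjects.fibreAl N (ofRealVec q)` on the punctured real zone, in LANDED currency

NOT IN PRINT; OUR PROOF ATTEMPT.  HONEST FRAMING (cell contract, verbatim): «discharging `BetaPertH` makes Bałaban's UV stability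
UNCONDITIONAL — a real constructive-QFT result; it is NOT the continuum limit and NOT the Clay problem.»  HONEST DEPENDENCY (verbatim):
«continuum YM on T⁴ ⇐ BetaPertH ∧ nine spine estimates (0/9 proved); BetaPertH ⇐ (D1) ∧ (D4) ∧ CAP+tail; G-an2-4 gates asym, D1 and
NE2/3/4.»  [folklore] bookkeeping over `ℝ`/`ℂ` BY NAME from the landed leaves: T00 `AliasObjects` (`fibreAl`, real-zone conjugation facts), P1-L06
`AliasWeights(+Sum)` (`four_le_sq_mul_lapR`, `alias_sum_le`, `aliasWtConst`), Y08s `CapacitanceScalarBounds(+Border)` (`blockWt`, `gNormSq`, `capDiag_le`,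
`capDiag_term_le`, `capBorder_ge`, `capBorder_term_le`, `pow_le_blockWt_zero`, `sq_le_gNormSq_zero`, `four_sin_sq_sum_bounds`), leaf-12's
`CapacitanceScalarDictionary` (via `CapacitanceCancellationDefect`) (`norm_sq_sAl`, `normSq_SAl`, `wAl_ofRealVec`, `LAl_ofRealVec`, `sigma_fibreAl`), Y08f `CapacitanceClosedForm.capV_eq` +
`CapacitanceClosedFormAlias.fibreAl_T1` (telescoping (T1)); no cited fact, no wall binder, no `def`, no unit sequence touched (ref2 c2/c3).
NOT summit progress; discharges nothing of the K-slot `GAN24.CombesThomas.ConvCK 3 Lc`.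

## What is proved (`F = fibreAl N (ofRealVec q) h`, `q ∈ [−π, π]^D`, `h : ∀ m, L_m ≠ 0`; `m₀ = 0` the zero alias; `W = aliasWtConst D`)
* §1 DICTIONARY: `realZone` (`∂♭ = conj ∂`), `blkLap_eq` (`ℓ_m = lapR k_m`), `norm_wQ_sq` (`‖wQ_{mκ}‖² = N^D·w_m·gNormSq k_{mκ}`), `norm_wG_sq`
  (`‖wG_m‖² = w_m/N^D`), `feedback_sum_eq` (`Σ_{m∈s} wQ_{mκ}∂_{mκ}wG_m/L_m² = ∂̂_κ(p)·Σ_{m∈s} w_m/L_m²` — (T1)), `capV_fibreAl` (`capV = capBorder·∂̂(p)`),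
  `norm_dhat_sq` (`‖∂̂_κ(p)‖² = 4 sin²(q_κ/2)`) (`|q|² ≤ Dπ²` and `0 ≤ aliasWtConst D` are `CapacitanceCancellationDefect.momSq_le_of_abs_le` /
  `CapacitanceEndpointBlocks.aliasWtConst_nonneg` BY NAME);
* §2 THE CONSTANTS: `lam_le` (`4/N² ≤ ℓ_m`, `m ≠ 0`), `beta_sq_le` (`(4/π²)^{D+1}N^{2D+2} ≤ ‖wQ_{0κ}‖²`), `aOff_le` (`Σ_{m≠0}‖wQ_{mκ}‖²/ℓ_m ≤ N^{2D+4}W`),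
  `borderOff_le` (`Σ_{m≠0} w_m/L_m² ≤ (N^{D+4}/4)W`), `bOff_sq_le` (`‖feedback‖² ≤ |q|²(N^{D+4}W/4)²`), `gOff_le` (`Σ_{m≠0}‖wG_m‖²/ℓ_m³ ≤ (N⁶/16)W`);
* §3 `aFull_eq` (`Σ_m‖wQ_{mκ}‖²/ℓ_m = 2N^D·capDiag`), `aFull_le` (`≤ 2N^D·N^{D+4}(π²/(8|q|²) + W/2)`, `q ≠ 0`), `sum_norm_capV_sq_ge`
  (`((4/π²)^D N^{D+4}/|q|⁴)²·(4/π²)|q|² ≤ Σ_κ‖capV_κ‖²`).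
PART 4 (`FibreKernelControlAliasBound`) assembles: `‖c‖² ≤ K_c(D,|q|²)E/N⁴`, `Σ‖A‖² ≤ K_A(D,|q|²)·N²·E`.
Unit `b2b-balaban-gan24-formalise-leaf-10` (G-an2-4 formalisation swarm), 2026-08-20.
-/

noncomputable section

open Complex Finset
open scoped BigOperators Real ComplexConjugate
open Literature.Probability.LatticeModels (TorusSite)
open Literature.MathematicalPhysics.QuantumFieldTheory.Balaban1983to89.B4Strip (ofRealVec)
open Literature.MathematicalPhysics.QuantumFieldTheory.King1986 (momSq momSq_nonneg)

namespace Summit.QuantumFields.BalabanUV.Beta.GAN24.FibreKernelControlAlias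

open FibreSymbols (dhat dflat lapSym)
open FibreBlockSolve (dot)
open CapacitanceSolve (Fibre GRows QRows capV)
open AliasWeights AliasWeightsSum CapacitanceScalarBounds CapacitanceScalarBoundsBorder
open AliasObjects (kAl sAl SAl sbAl SbAl chiAl wAl dAl dbAl LAl fibreAl conj_ofRealVec dbAl_eq_conj SbAl_eq_conj)
open CapacitanceScalarDictionary (kAl_ofRealVec norm_sq_sAl normSq_SAl wAl_ofRealVec LAl_ofRealVec LAl_ofRealVec_ne_zero
  norm_dhat_ofRealVec_le_sqrt sigma_fibreAl)
open FibreKernelControl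

variable {D : ℕ} {N : ℕ} [NeZero N]

/-! ## §1 Dictionary: the alias fibre at a real momentum in the currency of `FibreKernelControl` -/

/-- [folklore] The alias fibre is on the REAL ZONE at `p = ofRealVec q`: `∂♭_m = conj ∂_m`. -/
theorem realZone (q : Fin D → ℝ) (h : ∀ m, LAl N (ofRealVec q) m ≠ 0) :
    ∀ m κ, (fibreAl N (ofRealVec q) h).db m κ = conj ((fibreAl N (ofRealVec q) h).dd m κ) :=
  fun m κ => dbAl_eq_conj (conj_ofRealVec q) m κ

/-- [folklore] The real Laplacian weight of the fibre is leaf P1-L06's `lapR`: `ℓ_m = lapR k_m`. -/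
theorem blkLap_eq (q : Fin D → ℝ) (h : ∀ m, LAl N (ofRealVec q) m ≠ 0) (m : TorusSite D N) :
    blkLap ((fibreAl N (ofRealVec q) h).dd m) = lapR (kfine N q m) := by
  have h1 := L_eq_blkLap (fibreAl N (ofRealVec q) h) (realZone q h) m
  have h2 : (fibreAl N (ofRealVec q) h).L m = ((lapR (kfine N q m) : ℝ) : ℂ) := LAl_ofRealVec q m
  exact_mod_cast h1.symm.trans h2

omit [NeZero N] in
/-- [folklore] `Π_i gNormSq N k_{m,i} = N^D · blockWt N q m`. -/
theorem prod_gNormSq_eq [NeZero N] (q : Fin D → ℝ) (m : TorusSite D N) :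
    ∏ i, gNormSq N (kfine N q m i) = (N : ℝ) ^ D * blockWt N q m := by
  have hN : (N : ℝ) ^ D ≠ 0 := pow_ne_zero _ (Nat.cast_ne_zero.mpr (NeZero.ne N))
  unfold blockWt
  field_simp

/-- [folklore] **Q-row weights**: `‖wQ_{mκ}‖² = ‖S(m)‖²‖s_κ(m)‖² = N^D · w_m · gNormSq N k_{m,κ}`. -/
theorem norm_wQ_sq (q : Fin D → ℝ) (h : ∀ m, LAl N (ofRealVec q) m ≠ 0) (m : TorusSite D N) (κ : Fin D) :
    ‖(fibreAl N (ofRealVec q) h).wQ m κ‖ ^ 2 = (N : ℝ) ^ D * blockWt N q m * gNormSq N (kfine N q m κ) := by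
  show ‖SAl N (ofRealVec q) m * sAl N (ofRealVec q) m κ‖ ^ 2 = _
  rw [norm_mul, mul_pow, norm_sq_sAl, ← Complex.normSq_eq_norm_sq, normSq_SAl, prod_gNormSq_eq]

/-- [folklore] **G-row weights**: `‖wG_m‖² = ‖χ̂(m)‖² = w_m / N^D`. -/
theorem norm_wG_sq (q : Fin D → ℝ) (h : ∀ m, LAl N (ofRealVec q) m ≠ 0) (m : TorusSite D N) :
    ‖(fibreAl N (ofRealVec q) h).wG m‖ ^ 2 = blockWt N q m / (N : ℝ) ^ D := by
  show ‖chiAl N (ofRealVec q) m‖ ^ 2 = _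
  have hN : (N : ℝ) ^ D ≠ 0 := pow_ne_zero _ (Nat.cast_ne_zero.mpr (NeZero.ne N))
  rw [AliasObjects.chiAl_eq_conj (conj_ofRealVec q), norm_div, Complex.norm_conj, norm_pow, Complex.norm_natCast, div_pow,
    ← Complex.normSq_eq_norm_sq, normSq_SAl, prod_gNormSq_eq]
  field_simp

/-- [folklore] `wM_m · wG_m = w_m = ↑(blockWt N q m)` (`S(m)·χ̂(m)`). -/
theorem wM_mul_wG (q : Fin D → ℝ) (h : ∀ m, LAl N (ofRealVec q) m ≠ 0) (m : TorusSite D N) :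
    (fibreAl N (ofRealVec q) h).wM m * (fibreAl N (ofRealVec q) h).wG m = ((blockWt N q m : ℝ) : ℂ) := by
  show SAl N (ofRealVec q) m * chiAl N (ofRealVec q) m = _
  exact wAl_ofRealVec q m

/-- [folklore] **THE GAUGE FEEDBACK SUM IS LONGITUDINAL** (telescoping (T1) of leaf-02, `fibreAl_T1`): for every alias set `s`,
`Σ_{m∈s} wQ_{mκ}∂_{mκ}wG_m/L_m² = ∂̂_κ(p) · Σ_{m∈s} w_m/L_m²`, a coarse symbol times a REAL nonnegative alias sum. -/
theorem feedback_sum_eq (q : Fin D → ℝ) (h : ∀ m, LAl N (ofRealVec q) m ≠ 0) (s : Finset (TorusSite D N)) (κ : Fin D) :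
    ∑ m ∈ s, (fibreAl N (ofRealVec q) h).wQ m κ * (fibreAl N (ofRealVec q) h).dd m κ * (fibreAl N (ofRealVec q) h).wG m
        / (fibreAl N (ofRealVec q) h).L m ^ 2
      = dhat (ofRealVec q) κ * ((∑ m ∈ s, blockWt N q m / lapR (kfine N q m) ^ 2 : ℝ) : ℂ) := by
  push_cast
  rw [Finset.mul_sum]
  refine Finset.sum_congr rfl fun m _ => ?_
  rw [CapacitanceClosedFormAlias.fibreAl_T1 N (ofRealVec q) h m κ,
    show (fibreAl N (ofRealVec q) h).wM m * dhat (ofRealVec q) κ * (fibreAl N (ofRealVec q) h).wG m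
        / (fibreAl N (ofRealVec q) h).L m ^ 2
      = dhat (ofRealVec q) κ * ((fibreAl N (ofRealVec q) h).wM m * (fibreAl N (ofRealVec q) h).wG m)
        / (fibreAl N (ofRealVec q) h).L m ^ 2 by ring,
    wM_mul_wG q h m, show (fibreAl N (ofRealVec q) h).L m = LAl N (ofRealVec q) m from rfl, LAl_ofRealVec q m]
  ring

/-- [folklore] **THE BORDER**: `capV F κ = σ·∂̂_κ(p)` with `σ = ↑(capBorder N q)` (leaf-02 `capV_eq` + leaf-12 `sigma_fibreAl`). -/
theorem capV_fibreAl (q : Fin D → ℝ) (h : ∀ m, LAl N (ofRealVec q) m ≠ 0) (κ : Fin D) :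
    capV (fibreAl N (ofRealVec q) h) κ = ((capBorder N q : ℝ) : ℂ) * dhat (ofRealVec q) κ := by
  rw [CapacitanceClosedForm.capV_eq (fibreAl N (ofRealVec q) h) (dhat (ofRealVec q))
    (CapacitanceClosedFormAlias.fibreAl_T1 N (ofRealVec q) h) κ, sigma_fibreAl q h]

/-- [folklore] `‖∂̂_κ(p)‖² = 4 sin²(q_κ/2)` at `p = ofRealVec q`. -/
theorem norm_dhat_sq (q : Fin D → ℝ) (κ : Fin D) : ‖dhat (ofRealVec q) κ‖ ^ 2 = 4 * Real.sin (q κ / 2) ^ 2 := by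
  have hconj : dflat (ofRealVec q) κ = conj (dhat (ofRealVec q) κ) := FibreGaffney.dflat_eq_conj_dhat (fun μ => conj_ofRealVec q μ) κ
  have h := SymbolTaylor.dhat_mul_dflat_self_ofRealVec q κ
  rw [hconj, Complex.mul_conj, Complex.normSq_eq_norm_sq] at h
  exact_mod_cast h

/-! ## §2 The five displayed constants of `sum_normSq_le_energy_sq` for the alias fibre (all `N`-uniform in scaled units) -/

/-- [folklore] (λ) GOOD ALIASES ARE MASSIVE IN FINE UNITS: `4/N² ≤ ℓ_m` for `m ≠ 0` (leaf P1-L06 `four_le_sq_mul_lapR`). -/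
theorem lam_le (q : Fin D → ℝ) (hq : ∀ i, |q i| ≤ π) (h : ∀ m, LAl N (ofRealVec q) m ≠ 0) (m : TorusSite D N) (hm : m ≠ 0) :
    4 / (N : ℝ) ^ 2 ≤ blkLap ((fibreAl N (ofRealVec q) h).dd m) := by
  have hN : (0 : ℝ) < (N : ℝ) ^ 2 := pow_pos (Nat.cast_pos.mpr (Nat.pos_of_ne_zero (NeZero.ne N))) 2
  rw [blkLap_eq q h m, div_le_iff₀ hN, mul_comm]
  exact four_le_sq_mul_lapR hq hm

/-- [folklore] (β2) THE ZERO ALIAS' Q-COLUMNS ARE INJECTIVE WITH CONSTANT: `(4/π²)^{D+1}·N^{2D+2} ≤ ‖wQ_{0κ}‖²` (Jordan twice: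
`pow_le_blockWt_zero`, `sq_le_gNormSq_zero`). -/
theorem beta_sq_le (hN : 1 ≤ N) (q : Fin D → ℝ) (hq : ∀ i, |q i| ≤ π) (h : ∀ m, LAl N (ofRealVec q) m ≠ 0) (κ : Fin D) :
    (4 / π ^ 2) ^ (D + 1) * (N : ℝ) ^ (2 * D + 2) ≤ ‖(fibreAl N (ofRealVec q) h).wQ 0 κ‖ ^ 2 := by
  have hN0 : (0 : ℝ) < N := by exact_mod_cast hN
  rw [norm_wQ_sq]
  have h1 := pow_le_blockWt_zero hN hq (N := N)
  have h2 : 4 / π ^ 2 * (N : ℝ) ^ 2 ≤ gNormSq N (kfine N q 0 κ) := by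
    rw [kfine_zero]; exact sq_le_gNormSq_zero hN (hq κ)
  calc (4 / π ^ 2) ^ (D + 1) * (N : ℝ) ^ (2 * D + 2)
      = (N : ℝ) ^ D * ((4 / π ^ 2) ^ D * (N : ℝ) ^ D) * (4 / π ^ 2 * (N : ℝ) ^ 2) := by ring
    _ ≤ (N : ℝ) ^ D * blockWt N q 0 * gNormSq N (kfine N q 0 κ) :=
        mul_le_mul (mul_le_mul_of_nonneg_left h1 (by positivity)) h2 (by positivity)
          (mul_nonneg (by positivity) (blockWt_nonneg _ _ _))

/-- [folklore] (aO) THE GOOD ALIASES' Q-WEIGHT SUM: `Σ_{m≠0} ‖wQ_{mκ}‖²/ℓ_m ≤ N^{2D+4}·aliasWtConst D`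
(`= 2N^D ×` the `m ≠ 0` share of leaf-12's `capDiag`; `capDiag_term_le` + `alias_sum_le`). -/
theorem aOff_le (hN : 1 ≤ N) (q : Fin D → ℝ) (hq : ∀ i, |q i| ≤ π) (h : ∀ m, LAl N (ofRealVec q) m ≠ 0) (κ : Fin D) :
    ∑ m ∈ Finset.univ.erase 0, ‖(fibreAl N (ofRealVec q) h).wQ m κ‖ ^ 2 / blkLap ((fibreAl N (ofRealVec q) h).dd m)
      ≤ (N : ℝ) ^ (2 * D + 4) * aliasWtConst D := by
  classical
  have hN0 : (0 : ℝ) < N := by exact_mod_cast hN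
  have hterm : ∀ m ∈ (Finset.univ : Finset (TorusSite D N)).erase 0,
      ‖(fibreAl N (ofRealVec q) h).wQ m κ‖ ^ 2 / blkLap ((fibreAl N (ofRealVec q) h).dd m)
        ≤ (N : ℝ) ^ (2 * D + 4) * aliasWtTerm N q m := by
    intro m hm
    have hm0 : m ≠ 0 := Finset.ne_of_mem_erase hm
    rw [norm_wQ_sq, blkLap_eq q h m]
    have h1 := capDiag_term_le hN hq κ hm0
    have hL := lapR_pos_of_ne_zero hq hm0
    have e : (N : ℝ) ^ D * blockWt N q m * gNormSq N (kfine N q m κ) / lapR (kfine N q m)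
        = 2 * (N : ℝ) ^ D * (blockWt N q m * gNormSq N (kfine N q m κ) / (2 * lapR (kfine N q m))) := by
      field_simp
    rw [e]
    calc 2 * (N : ℝ) ^ D * (blockWt N q m * gNormSq N (kfine N q m κ) / (2 * lapR (kfine N q m)))
        ≤ 2 * (N : ℝ) ^ D * ((N : ℝ) ^ (D + 4) / 2 * aliasWtTerm N q m) := mul_le_mul_of_nonneg_left h1 (by positivity)
      _ = (N : ℝ) ^ (2 * D + 4) * aliasWtTerm N q m := by ring
  calc ∑ m ∈ Finset.univ.erase 0, ‖(fibreAl N (ofRealVec q) h).wQ m κ‖ ^ 2 / blkLap ((fibreAl N (ofRealVec q) h).dd m)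
      ≤ ∑ m ∈ Finset.univ.erase 0, (N : ℝ) ^ (2 * D + 4) * aliasWtTerm N q m := Finset.sum_le_sum hterm
    _ = (N : ℝ) ^ (2 * D + 4) * ∑ m ∈ Finset.univ.erase 0, aliasWtTerm N q m := by rw [Finset.mul_sum]
    _ ≤ (N : ℝ) ^ (2 * D + 4) * aliasWtConst D := mul_le_mul_of_nonneg_left (alias_sum_le N hq) (by positivity)

/-- [folklore] The off-zero border share: `Σ_{m≠0} w_m/L_m² ≤ (N^{D+4}/4)·aliasWtConst D` (`capBorder_term_le` + `alias_sum_le`). -/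
theorem borderOff_le (hN : 1 ≤ N) (q : Fin D → ℝ) (hq : ∀ i, |q i| ≤ π) :
    ∑ m ∈ (Finset.univ : Finset (TorusSite D N)).erase 0, blockWt N q m / lapR (kfine N q m) ^ 2
      ≤ (N : ℝ) ^ (D + 4) / 4 * aliasWtConst D := by
  classical
  have hN0 : (0 : ℝ) < N := by exact_mod_cast hN
  calc ∑ m ∈ (Finset.univ : Finset (TorusSite D N)).erase 0, blockWt N q m / lapR (kfine N q m) ^ 2
      ≤ ∑ m ∈ (Finset.univ : Finset (TorusSite D N)).erase 0, (N : ℝ) ^ (D + 4) / 4 * aliasWtTerm N q m :=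
        Finset.sum_le_sum fun m hm => capBorder_term_le hN hq (Finset.ne_of_mem_erase hm)
    _ = (N : ℝ) ^ (D + 4) / 4 * ∑ m ∈ (Finset.univ : Finset (TorusSite D N)).erase 0, aliasWtTerm N q m := by
        rw [Finset.mul_sum]
    _ ≤ (N : ℝ) ^ (D + 4) / 4 * aliasWtConst D := mul_le_mul_of_nonneg_left (alias_sum_le N hq) (by positivity)

/-- [folklore] (bO2) THE GAUGE FEEDBACK ON THE ZERO ALIAS: `‖Σ_{m≠0} wQ_{mκ}∂_{mκ}wG_m/L_m²‖² ≤ |q|²·((N^{D+4}/4)·aliasWtConst D)²`. -/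
theorem bOff_sq_le (hN : 1 ≤ N) (q : Fin D → ℝ) (hq : ∀ i, |q i| ≤ π) (h : ∀ m, LAl N (ofRealVec q) m ≠ 0) (κ : Fin D) :
    ‖∑ m ∈ Finset.univ.erase 0, (fibreAl N (ofRealVec q) h).wQ m κ * (fibreAl N (ofRealVec q) h).dd m κ
        * (fibreAl N (ofRealVec q) h).wG m / (fibreAl N (ofRealVec q) h).L m ^ 2‖ ^ 2
      ≤ momSq q * ((N : ℝ) ^ (D + 4) / 4 * aliasWtConst D) ^ 2 := by
  classical
  rw [feedback_sum_eq q h _ κ, norm_mul, mul_pow, Complex.norm_real, Real.norm_eq_abs,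
    abs_of_nonneg (Finset.sum_nonneg fun m _ => div_nonneg (blockWt_nonneg _ _ _) (sq_nonneg _))]
  have h1 : ‖dhat (ofRealVec q) κ‖ ^ 2 ≤ momSq q := by
    calc ‖dhat (ofRealVec q) κ‖ ^ 2 ≤ Real.sqrt (momSq q) ^ 2 := pow_le_pow_left₀ (norm_nonneg _) (norm_dhat_ofRealVec_le_sqrt q κ) 2
      _ = momSq q := Real.sq_sqrt (momSq_nonneg q)
  exact mul_le_mul h1 (pow_le_pow_left₀ (Finset.sum_nonneg fun m _ => div_nonneg (blockWt_nonneg _ _ _) (sq_nonneg _))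
    (borderOff_le hN q hq) 2) (sq_nonneg _) (momSq_nonneg q)

/-- [folklore] (gO) THE GOOD ALIASES' GAUGE WEIGHT: `Σ_{m≠0} ‖wG_m‖²/ℓ_m³ ≤ (N⁶/16)·aliasWtConst D`
(`‖wG_m‖² = w_m/N^D`, `1/ℓ_m ≤ N²/4`, `w_m/ℓ_m² ≤ (N^{D+4}/4)·aliasWtTerm`). -/
theorem gOff_le (hN : 1 ≤ N) (q : Fin D → ℝ) (hq : ∀ i, |q i| ≤ π) (h : ∀ m, LAl N (ofRealVec q) m ≠ 0) :
    ∑ m ∈ Finset.univ.erase 0, ‖(fibreAl N (ofRealVec q) h).wG m‖ ^ 2 / blkLap ((fibreAl N (ofRealVec q) h).dd m) ^ 3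
      ≤ (N : ℝ) ^ 6 / 16 * aliasWtConst D := by
  classical
  have hN0 : (0 : ℝ) < N := by exact_mod_cast hN
  have hterm : ∀ m ∈ (Finset.univ : Finset (TorusSite D N)).erase 0,
      ‖(fibreAl N (ofRealVec q) h).wG m‖ ^ 2 / blkLap ((fibreAl N (ofRealVec q) h).dd m) ^ 3
        ≤ (N : ℝ) ^ 6 / 16 * aliasWtTerm N q m := by
    intro m hm
    have hm0 : m ≠ 0 := Finset.ne_of_mem_erase hm
    rw [norm_wG_sq, blkLap_eq q h m]
    have hL := lapR_pos_of_ne_zero hq hm0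
    have h4 := four_le_sq_mul_lapR hq hm0
    have hb := capBorder_term_le hN hq hm0
    set L := lapR (kfine N q m) with hLdef
    -- `w/N^D/L³ = (w/L²) · (1/(N^D L))` and `1/(N^D L) ≤ N²/(4 N^D)`
    have e : blockWt N q m / (N : ℝ) ^ D / L ^ 3 = (blockWt N q m / L ^ 2) * (1 / ((N : ℝ) ^ 2 * L)) * ((N : ℝ) ^ 2 / (N : ℝ) ^ D) := by
      field_simp
    have h3 : 1 / ((N : ℝ) ^ 2 * L) ≤ 1 / 4 := div_le_div_of_nonneg_left zero_le_one (by norm_num) h4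
    rw [e]
    have ht0 : 0 ≤ (N : ℝ) ^ (D + 4) / 4 * aliasWtTerm N q m := mul_nonneg (by positivity) (aliasWtTerm_nonneg _ _ _)
    calc blockWt N q m / L ^ 2 * (1 / ((N : ℝ) ^ 2 * L)) * ((N : ℝ) ^ 2 / (N : ℝ) ^ D)
        ≤ ((N : ℝ) ^ (D + 4) / 4 * aliasWtTerm N q m) * (1 / 4) * ((N : ℝ) ^ 2 / (N : ℝ) ^ D) :=
          mul_le_mul_of_nonneg_right (mul_le_mul hb h3 (by positivity) ht0) (by positivity)
      _ = (N : ℝ) ^ 6 / 16 * aliasWtTerm N q m := by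
          rw [pow_add]; field_simp; ring
  calc ∑ m ∈ Finset.univ.erase 0, ‖(fibreAl N (ofRealVec q) h).wG m‖ ^ 2 / blkLap ((fibreAl N (ofRealVec q) h).dd m) ^ 3
      ≤ ∑ m ∈ Finset.univ.erase 0, (N : ℝ) ^ 6 / 16 * aliasWtTerm N q m := Finset.sum_le_sum hterm
    _ = (N : ℝ) ^ 6 / 16 * ∑ m ∈ Finset.univ.erase 0, aliasWtTerm N q m := by rw [Finset.mul_sum]
    _ ≤ (N : ℝ) ^ 6 / 16 * aliasWtConst D := mul_le_mul_of_nonneg_left (alias_sum_le N hq) (by positivity)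

/-! ## §3 The full Q-weight sum and the border from below (inputs of (o1)) -/

/-- [folklore] THE FULL Q-WEIGHT SUM IS `2N^D·a_κ`: `Σ_m ‖wQ_{mκ}‖²/ℓ_m = 2N^D · capDiag N q κ` (leaf-12's diagonal scalar). -/
theorem aFull_eq (q : Fin D → ℝ) (h : ∀ m, LAl N (ofRealVec q) m ≠ 0) (κ : Fin D) :
    ∑ m, ‖(fibreAl N (ofRealVec q) h).wQ m κ‖ ^ 2 / blkLap ((fibreAl N (ofRealVec q) h).dd m) = 2 * (N : ℝ) ^ D * capDiag N q κ := by
  unfold capDiag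
  rw [Finset.mul_sum]
  refine Finset.sum_congr rfl fun m _ => ?_
  rw [norm_wQ_sq, blkLap_eq q h m]
  have hL : lapR (kfine N q m) ≠ 0 := by
    have := blkLap_pos (fibreAl N (ofRealVec q) h) (realZone q h) m
    rw [blkLap_eq q h m] at this
    exact this.ne'
  field_simp

/-- [folklore] … hence `Σ_m ‖wQ_{mκ}‖²/ℓ_m ≤ 2N^D · N^{D+4}(π²/(8|q|²) + aliasWtConst D/2)` on `BZ∖{0}` (leaf-12 `capDiag_le`). -/
theorem aFull_le (hN : 1 ≤ N) (q : Fin D → ℝ) (hq : ∀ i, |q i| ≤ π) (hq0 : q ≠ 0) (h : ∀ m, LAl N (ofRealVec q) m ≠ 0) (κ : Fin D) :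
    ∑ m, ‖(fibreAl N (ofRealVec q) h).wQ m κ‖ ^ 2 / blkLap ((fibreAl N (ofRealVec q) h).dd m)
      ≤ 2 * (N : ℝ) ^ D * ((N : ℝ) ^ (D + 4) * (π ^ 2 / (8 * momSq q) + aliasWtConst D / 2)) := by
  rw [aFull_eq q h κ]
  exact mul_le_mul_of_nonneg_left (capDiag_le hN hq hq0 κ) (by positivity)

/-- [folklore] THE BORDER FROM BELOW, summed over polarisations:
`((4/π²)^D·N^{D+4}/|q|⁴)²·((4/π²)|q|²) ≤ Σ_κ ‖capV F κ‖²` (`capV = σ∂̂(p)`, leaf-12 `capBorder_ge`, Jordan `four_sin_sq_sum_bounds`). -/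
theorem sum_norm_capV_sq_ge (hN : 1 ≤ N) (q : Fin D → ℝ) (hq : ∀ i, |q i| ≤ π) (hq0 : q ≠ 0) (h : ∀ m, LAl N (ofRealVec q) m ≠ 0) :
    ((4 / π ^ 2) ^ D * (N : ℝ) ^ (D + 4) / momSq q ^ 2) ^ 2 * (4 / π ^ 2 * momSq q)
      ≤ ∑ κ, ‖capV (fibreAl N (ofRealVec q) h) κ‖ ^ 2 := by
  have hσ := capBorder_ge hN hq hq0
  have hσ0 : 0 ≤ (4 / π ^ 2) ^ D * (N : ℝ) ^ (D + 4) / momSq q ^ 2 := by positivity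
  have hsum : ∑ κ, ‖capV (fibreAl N (ofRealVec q) h) κ‖ ^ 2 = capBorder N q ^ 2 * ∑ κ, 4 * Real.sin (q κ / 2) ^ 2 := by
    rw [Finset.mul_sum]
    refine Finset.sum_congr rfl fun κ _ => ?_
    rw [capV_fibreAl q h κ, norm_mul, mul_pow, Complex.norm_real, Real.norm_eq_abs,
      abs_of_nonneg (le_trans hσ0 hσ), norm_dhat_sq]
  rw [hsum]
  exact mul_le_mul (pow_le_pow_left₀ hσ0 hσ 2) (four_sin_sq_sum_bounds hq).1 (mul_nonneg (by positivity) (momSq_nonneg q))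
    (sq_nonneg _)

end Summit.QuantumFields.BalabanUV.Beta.GAN24.FibreKernelControlAlias

end
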